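import Summits.QuantumFields.BalabanUV.Beta.FP.TorusCompositeCovarianceTwoPolar
import Summits.QuantumFields.BalabanUV.Beta.FP.TorusCompositeCovarianceTwoRows

/-!
# `BalabanUV.Beta.FP.TorusCompositeRowsDirectional` — road «FP» for binder row D1, ROUTE T: **THE `Q`-SIDE OF THE TOWER's DOOR READ AS FUNCTIONS OF THE DIRECTION —
# (BI)LINEARITY OF OUR COMPOSITE JETS ALONG A LINEAR READ-OUT `h := hv v`, AND #21's `c2` ROW AT THE POLARISED FINE JET `c² • compIns₂₂ h h`**
# (the eight `Q`-side obligations of the OWNER d1-p3 g27's adapter #41c `NestedDoorSocketTower` (staged 38766b9a9aa4174c :121–127, :162–164) at the record of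
# this lineage's ♭ tower — supplied BY NAME, so the END's per-direction plug is one term each)

WHY.  #41c displays, for a direction module `V` with read-out `hv`, the jets `Q₁₁f Q₂₁f` (linear), `Q₁₂f Q₂₂f` (linear in each of two slots) and the rows `c1 c2 d1 d2`
for every direction.  At the record of OUR ♭ tower: `Q₁₁f v := c • compIns₁ (hv v)` (C2), `Q₁₂f v v′ := c² • compIns₂₂ (hv v) (hv v′)` (R-5), `Q₂₁f v :=` the top
step's rooted member along `(cθ_{n+1})•(compRows·hv v)` (g22), `Q₂₂f v v′ := c_{lev 0} •` the top step's bi-member along the two transported directions (I-5 ∕ R-3).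
This file proves their (bi)linearity in #41c's literal hypothesis shapes `∀ (r : ℝ) (x y : V), F (r • x + y) = r • F x + F y` from `hv`'s, and #21's `c2` row with
the fine second jet read on the DIAGONAL of the bilinear companion (`compIns₂₂_self` + I-5 `torus_c2_tower`); `c1 d1` are C2's `torus_c1_tower ∕ torus_d1_tower`
and `d2` is I-5's `torus_d2_tower` VERBATIM at `h := hv v` (no wrapper needed).

WHAT.  §1 `Q11f_lin`, `Q21f_lin`, `Q12f_lin_left ∕ _right`, `Q22f_lin_left ∕ _right`; §2 `torus_c2_tower_polar`.  [folklore] finite sums BY NAME; no `def`, no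
`def … : Prop`, nothing cited, 0 sorry.  Nothing of the dictionary ∕ Bałaban's asserted (OUR ♭ objects = the admissible working presentation, R-D1-g46-1).

HONEST DEPENDENCY (page 1, mandatory): continuum YM on T⁴ ⇐ BetaPertH ∧ nine spine estimates (0/9 proved); BetaPertH ⇐ (D1) ∧ (D4) ∧ CAP+tail;
G-an2-4 gates asym, D1 and NE2/3/4.  HONEST FRAMING (cell contract, verbatim): «discharging `BetaPertH` makes Bałaban's UV stability UNCONDITIONAL —
a real constructive-QFT result; it is NOT the continuum limit and NOT the Clay problem.»  ABSOLUTE RULE (cell charter, verbatim): «No internally-minted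
statement may enter as a cited fact. Every hypothesis is either kernel-proved in this package or a verbatim quotation of a PUBLISHED theorem with page
reference. The manuscript(s) under audit are NOT citable for their own disputed steps — they are the thing under adjudication; programme-internal
(2001/route/tribunal) claims are never citable.»  0 estimates; 0∕4 row-D1 binders (hW, hR, D1Tel, D1Rep); NOT (T-ID), NOT (J-a) complete, NOT SDF, NOT D1,
NOT BetaPertH, NOT continuum, NOT Clay.  D1 formalisation swarm LEAF PROVER 02 (b2b-balaban-beta-d1-formalise-leaf-02 gen 26), 2026-08-23.  No existing file touched.
-/

noncomputable section

open scoped BigOperators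

namespace Summit.QuantumFields.BalabanUV.Beta.FP.TorusCompositeRowsDirectional

open Matrix Finset
open Literature.MathematicalPhysics.QuantumFieldTheory
open Literature.MathematicalPhysics.QuantumFieldTheory.Balaban1983to89
open Literature.MathematicalPhysics.QuantumFieldTheory.Balaban1983to89.Beta
open ExpKernelCalculus (MKer)
open B4TorusKernel.MultiPeriod (translate)
open B5Prop11Plancherel (fine)
open B6Lemma24Torus (pbox)
open AffineAveraging (Site box toSite unitVec)
open AveragingHessianKernelsRooted (vhSAt)
open AveragingMixedJetTables (vh₂SAt)
open OneStepResolventKernel (Fib)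
open Summit.QuantumFields.BalabanUV.Beta.BorderedHessian (stepScale)
open Summit.QuantumFields.BalabanUV.Beta.FP.KernelPeriodisationFib (Idx perF)
open Summit.QuantumFields.BalabanUV.Beta.FP.KernelPeriodisationFibLoc (dper)
open Summit.QuantumFields.BalabanUV.Beta.FP.TorusGaugeCovariance (tdelta)
open Summit.QuantumFields.BalabanUV.Beta.FP.TorusCombRows (Res)
open Summit.QuantumFields.BalabanUV.Beta.FP.TorusCompositeObjects
open Summit.QuantumFields.BalabanUV.Beta.FP.TorusCompositeFP (evalN)
open Summit.QuantumFields.BalabanUV.Beta.FP.TorusCompositeCovarianceOne (compIns₁)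
open Summit.QuantumFields.BalabanUV.Beta.FP.TorusCompositeCovarianceTwo (compIns₂)
open Summit.QuantumFields.BalabanUV.Beta.FP.TorusCompositeIndexWardOne (compIns₁_add compIns₁_smul)
open Summit.QuantumFields.BalabanUV.Beta.FP.TorusCompositeCovarianceTwoPolar (compIns₂₂ compIns₂₂_self compIns₂₂_add_left compIns₂₂_smul_left compIns₂₂_add_right
  compIns₂₂_smul_right)
open Summit.QuantumFields.BalabanUV.Beta.FP.TorusCompositeCovarianceTwoRows (torus_c2_tower)

variable {d : ℕ}

section Directional

variable (Lc : ℕ) [NeZero Lc] (M' : Fin (d + 1) → ℕ) [∀ μ, NeZero (M' μ)] (lev : ℕ → ℕ) (rs : ℕ → (Fin (d + 1) → ℕ)) (n : ℕ) (c : ℝ)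
  {V : Type*} [AddCommGroup V] [Module ℝ V] (hv : V → (↥(pbox (towerTorus Lc M' (n + 1))) × Fin (d + 1) → ℝ))

/-! ## §1 (Bi)linearity of the `Q`-side jets along a linear read-out, in #41c's hypothesis shapes -/

/-- [folklore] **`Q₁₁f v := c • compIns₁ … (hv v)` IS LINEAR** (#41c's `hQ₁₁l` shape; g22 `compIns₁_add ∕ _smul`). -/
theorem Q11f_lin (hhv : ∀ (r : ℝ) (x y : V), hv (r • x + y) = r • hv x + hv y) :
    ∀ (r : ℝ) (x y : V), c • compIns₁ Lc M' lev rs (n + 1) (hv (r • x + y)) = r • (c • compIns₁ Lc M' lev rs (n + 1) (hv x)) + c • compIns₁ Lc M' lev rs (n + 1) (hv y) := by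
  intro r x y
  rw [hhv, compIns₁_add, compIns₁_smul, smul_add, smul_comm c r]

/-- [folklore] **`Q₁₂f v v′ := c² • compIns₂₂ … (hv v) (hv v′)` IS LINEAR IN THE FIRST SLOT** (#41c's `hQ₁₂l`; R-5 `compIns₂₂_add_left ∕ _smul_left`). -/
theorem Q12f_lin_left (hhv : ∀ (r : ℝ) (x y : V), hv (r • x + y) = r • hv x + hv y) :
    ∀ (r : ℝ) (x y z : V), c ^ 2 • compIns₂₂ Lc M' lev rs (n + 1) (hv (r • x + y)) (hv z) = r • (c ^ 2 • compIns₂₂ Lc M' lev rs (n + 1) (hv x) (hv z)) + c ^ 2 • compIns₂₂ Lc M' lev rs (n + 1) (hv y) (hv z) := by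
  intro r x y z
  rw [hhv, compIns₂₂_add_left, compIns₂₂_smul_left, smul_add, smul_comm (c ^ 2) r]

/-- [folklore] **… AND IN THE SECOND SLOT** (#41c's `hQ₁₂r`; R-5 `compIns₂₂_add_right ∕ _smul_right`, `rs k ∈ box`). -/
theorem Q12f_lin_right (hrs : ∀ k, rs k ∈ box (d + 1) Lc) (hhv : ∀ (r : ℝ) (x y : V), hv (r • x + y) = r • hv x + hv y) :
    ∀ (r : ℝ) (x y z : V), c ^ 2 • compIns₂₂ Lc M' lev rs (n + 1) (hv z) (hv (r • x + y)) = r • (c ^ 2 • compIns₂₂ Lc M' lev rs (n + 1) (hv z) (hv x)) + c ^ 2 • compIns₂₂ Lc M' lev rs (n + 1) (hv z) (hv y) := by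
  intro r x y z
  rw [hhv, compIns₂₂_add_right Lc (n + 1) M' lev rs hrs, compIns₂₂_smul_right Lc (n + 1) M' lev rs hrs, smul_add, smul_comm (c ^ 2) r]

/-- [folklore] **`Q₂₁f v :=` THE TOP STEP's ROOTED MEMBER ALONG `(cθ_{n+1})•(compRows·hv v)` IS LINEAR** (#41c's `hQ₂₁l`; g22's Σ-shape). -/
theorem Q21f_lin {κ : Type*} (pμ' : κ → ↥(pbox M')) (mμ' : κ → Fin (d + 1)) (hhv : ∀ (r : ℝ) (x y : V), hv (r • x + y) = r • hv x + hv y) :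
    ∀ (r : ℝ) (x y : V),
      (∑ a' : ↥(pbox M') × Fin (d + 1), ((c * (((Lc : ℝ) ^ (d + 1) * stepScale d Lc (lev 0)) * (∏ i ∈ range (n + 1), (stepScale d Lc (lev (i + 1)) * ((box (d + 1) Lc).card : ℝ)))⁻¹)) * (compRows Lc M' lev rs (n + 1) *ᵥ (hv (r • x + y))) a') •
        (perF M' (dper M' (vhSAt (toSite (rs 0)) d Lc rfl a'.2 (a'.1 : Site (d + 1))))).submatrix (fun k : κ => ((pμ' k, Sum.inr (mμ' k)) : Idx M' (Fib d)))
          (fun b : ↥(pbox M') × Fin (d + 1) => ((b.1, Sum.inl b.2) : Idx M' (Fib d))))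
        = r • (∑ a' : ↥(pbox M') × Fin (d + 1), ((c * (((Lc : ℝ) ^ (d + 1) * stepScale d Lc (lev 0)) * (∏ i ∈ range (n + 1), (stepScale d Lc (lev (i + 1)) * ((box (d + 1) Lc).card : ℝ)))⁻¹)) * (compRows Lc M' lev rs (n + 1) *ᵥ (hv x)) a') •
        (perF M' (dper M' (vhSAt (toSite (rs 0)) d Lc rfl a'.2 (a'.1 : Site (d + 1))))).submatrix (fun k : κ => ((pμ' k, Sum.inr (mμ' k)) : Idx M' (Fib d)))
          (fun b : ↥(pbox M') × Fin (d + 1) => ((b.1, Sum.inl b.2) : Idx M' (Fib d))))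
          + (∑ a' : ↥(pbox M') × Fin (d + 1), ((c * (((Lc : ℝ) ^ (d + 1) * stepScale d Lc (lev 0)) * (∏ i ∈ range (n + 1), (stepScale d Lc (lev (i + 1)) * ((box (d + 1) Lc).card : ℝ)))⁻¹)) * (compRows Lc M' lev rs (n + 1) *ᵥ (hv y)) a') •
        (perF M' (dper M' (vhSAt (toSite (rs 0)) d Lc rfl a'.2 (a'.1 : Site (d + 1))))).submatrix (fun k : κ => ((pμ' k, Sum.inr (mμ' k)) : Idx M' (Fib d)))
          (fun b : ↥(pbox M') × Fin (d + 1) => ((b.1, Sum.inl b.2) : Idx M' (Fib d)))) := by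
  intro r x y
  rw [hhv, Matrix.mulVec_add, Matrix.mulVec_smul, Finset.smul_sum, ← Finset.sum_add_distrib]
  refine Finset.sum_congr rfl fun a' _ => ?_
  rw [Pi.add_apply, Pi.smul_apply, smul_eq_mul, mul_add, add_smul, smul_smul]
  congr 2
  ring

/-- [folklore] **`Q₂₂f v v′ := c_{lev 0} •` THE TOP STEP's BI-MEMBER ALONG THE TWO TRANSPORTED DIRECTIONS IS LINEAR IN THE FIRST SLOT** (#41c's `hQ₂₂l`; I-5∕R-3's ΣΣ-shape). -/
theorem Q22f_lin_left {κ : Type*} (pμ' : κ → ↥(pbox M')) (mμ' : κ → Fin (d + 1)) (hhv : ∀ (r : ℝ) (x y : V), hv (r • x + y) = r • hv x + hv y) :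
    ∀ (r : ℝ) (x y z : V),
      (((Lc : ℝ) ^ (d + 1) * stepScale d Lc (lev 0))⁻¹ •
        ∑ b : ↥(pbox M') × Fin (d + 1), ∑ b' : ↥(pbox M') × Fin (d + 1), (((c * (((Lc : ℝ) ^ (d + 1) * stepScale d Lc (lev 0)) * (∏ i ∈ range (n + 1), (stepScale d Lc (lev (i + 1)) * ((box (d + 1) Lc).card : ℝ)))⁻¹)) * (compRows Lc M' lev rs (n + 1) *ᵥ (hv (r • x + y))) b) * ((c * (((Lc : ℝ) ^ (d + 1) * stepScale d Lc (lev 0)) * (∏ i ∈ range (n + 1), (stepScale d Lc (lev (i + 1)) * ((box (d + 1) Lc).card : ℝ)))⁻¹)) * (compRows Lc M' lev rs (n + 1) *ᵥ (hv z)) b')) •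
          (perF M' (dper M' (fun x z a e => ∑' m : Site (d + 1), (1 / 2 : ℝ) *
            (vh₂SAt (toSite (rs 0)) Lc b.2 (b.1 : Site (d + 1)) b'.2 (translate M' (b'.1 : Site (d + 1)) m) x z a e
              + vh₂SAt (toSite (rs 0)) Lc b'.2 (translate M' (b'.1 : Site (d + 1)) m) b.2 (b.1 : Site (d + 1)) x z a e)))).submatrix
            (fun k : κ => ((pμ' k, Sum.inr (mμ' k)) : Idx M' (Fib d))) (fun e : ↥(pbox M') × Fin (d + 1) => ((e.1, Sum.inl e.2) : Idx M' (Fib d))))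
        = r • (((Lc : ℝ) ^ (d + 1) * stepScale d Lc (lev 0))⁻¹ •
        ∑ b : ↥(pbox M') × Fin (d + 1), ∑ b' : ↥(pbox M') × Fin (d + 1), (((c * (((Lc : ℝ) ^ (d + 1) * stepScale d Lc (lev 0)) * (∏ i ∈ range (n + 1), (stepScale d Lc (lev (i + 1)) * ((box (d + 1) Lc).card : ℝ)))⁻¹)) * (compRows Lc M' lev rs (n + 1) *ᵥ (hv x)) b) * ((c * (((Lc : ℝ) ^ (d + 1) * stepScale d Lc (lev 0)) * (∏ i ∈ range (n + 1), (stepScale d Lc (lev (i + 1)) * ((box (d + 1) Lc).card : ℝ)))⁻¹)) * (compRows Lc M' lev rs (n + 1) *ᵥ (hv z)) b')) •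
          (perF M' (dper M' (fun x z a e => ∑' m : Site (d + 1), (1 / 2 : ℝ) *
            (vh₂SAt (toSite (rs 0)) Lc b.2 (b.1 : Site (d + 1)) b'.2 (translate M' (b'.1 : Site (d + 1)) m) x z a e
              + vh₂SAt (toSite (rs 0)) Lc b'.2 (translate M' (b'.1 : Site (d + 1)) m) b.2 (b.1 : Site (d + 1)) x z a e)))).submatrix
            (fun k : κ => ((pμ' k, Sum.inr (mμ' k)) : Idx M' (Fib d))) (fun e : ↥(pbox M') × Fin (d + 1) => ((e.1, Sum.inl e.2) : Idx M' (Fib d))))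
          + (((Lc : ℝ) ^ (d + 1) * stepScale d Lc (lev 0))⁻¹ •
        ∑ b : ↥(pbox M') × Fin (d + 1), ∑ b' : ↥(pbox M') × Fin (d + 1), (((c * (((Lc : ℝ) ^ (d + 1) * stepScale d Lc (lev 0)) * (∏ i ∈ range (n + 1), (stepScale d Lc (lev (i + 1)) * ((box (d + 1) Lc).card : ℝ)))⁻¹)) * (compRows Lc M' lev rs (n + 1) *ᵥ (hv y)) b) * ((c * (((Lc : ℝ) ^ (d + 1) * stepScale d Lc (lev 0)) * (∏ i ∈ range (n + 1), (stepScale d Lc (lev (i + 1)) * ((box (d + 1) Lc).card : ℝ)))⁻¹)) * (compRows Lc M' lev rs (n + 1) *ᵥ (hv z)) b')) •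
          (perF M' (dper M' (fun x z a e => ∑' m : Site (d + 1), (1 / 2 : ℝ) *
            (vh₂SAt (toSite (rs 0)) Lc b.2 (b.1 : Site (d + 1)) b'.2 (translate M' (b'.1 : Site (d + 1)) m) x z a e
              + vh₂SAt (toSite (rs 0)) Lc b'.2 (translate M' (b'.1 : Site (d + 1)) m) b.2 (b.1 : Site (d + 1)) x z a e)))).submatrix
            (fun k : κ => ((pμ' k, Sum.inr (mμ' k)) : Idx M' (Fib d))) (fun e : ↥(pbox M') × Fin (d + 1) => ((e.1, Sum.inl e.2) : Idx M' (Fib d)))) := by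
  intro r x y z
  rw [hhv, Matrix.mulVec_add, Matrix.mulVec_smul, smul_comm r, ← smul_add]
  congr 1
  rw [Finset.smul_sum, ← Finset.sum_add_distrib]
  refine Finset.sum_congr rfl fun b _ => ?_
  rw [Finset.smul_sum, ← Finset.sum_add_distrib]
  refine Finset.sum_congr rfl fun b' _ => ?_
  rw [Pi.add_apply, Pi.smul_apply, smul_eq_mul, smul_smul, ← add_smul]
  congr 1
  ring

/-- [folklore] **… AND IN THE SECOND SLOT** (#41c's `hQ₂₂r`). -/
theorem Q22f_lin_right {κ : Type*} (pμ' : κ → ↥(pbox M')) (mμ' : κ → Fin (d + 1)) (hhv : ∀ (r : ℝ) (x y : V), hv (r • x + y) = r • hv x + hv y) :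
    ∀ (r : ℝ) (x y z : V),
      (((Lc : ℝ) ^ (d + 1) * stepScale d Lc (lev 0))⁻¹ •
        ∑ b : ↥(pbox M') × Fin (d + 1), ∑ b' : ↥(pbox M') × Fin (d + 1), (((c * (((Lc : ℝ) ^ (d + 1) * stepScale d Lc (lev 0)) * (∏ i ∈ range (n + 1), (stepScale d Lc (lev (i + 1)) * ((box (d + 1) Lc).card : ℝ)))⁻¹)) * (compRows Lc M' lev rs (n + 1) *ᵥ (hv z)) b) * ((c * (((Lc : ℝ) ^ (d + 1) * stepScale d Lc (lev 0)) * (∏ i ∈ range (n + 1), (stepScale d Lc (lev (i + 1)) * ((box (d + 1) Lc).card : ℝ)))⁻¹)) * (compRows Lc M' lev rs (n + 1) *ᵥ (hv (r • x + y))) b')) •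
          (perF M' (dper M' (fun x z a e => ∑' m : Site (d + 1), (1 / 2 : ℝ) *
            (vh₂SAt (toSite (rs 0)) Lc b.2 (b.1 : Site (d + 1)) b'.2 (translate M' (b'.1 : Site (d + 1)) m) x z a e
              + vh₂SAt (toSite (rs 0)) Lc b'.2 (translate M' (b'.1 : Site (d + 1)) m) b.2 (b.1 : Site (d + 1)) x z a e)))).submatrix
            (fun k : κ => ((pμ' k, Sum.inr (mμ' k)) : Idx M' (Fib d))) (fun e : ↥(pbox M') × Fin (d + 1) => ((e.1, Sum.inl e.2) : Idx M' (Fib d))))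
        = r • (((Lc : ℝ) ^ (d + 1) * stepScale d Lc (lev 0))⁻¹ •
        ∑ b : ↥(pbox M') × Fin (d + 1), ∑ b' : ↥(pbox M') × Fin (d + 1), (((c * (((Lc : ℝ) ^ (d + 1) * stepScale d Lc (lev 0)) * (∏ i ∈ range (n + 1), (stepScale d Lc (lev (i + 1)) * ((box (d + 1) Lc).card : ℝ)))⁻¹)) * (compRows Lc M' lev rs (n + 1) *ᵥ (hv z)) b) * ((c * (((Lc : ℝ) ^ (d + 1) * stepScale d Lc (lev 0)) * (∏ i ∈ range (n + 1), (stepScale d Lc (lev (i + 1)) * ((box (d + 1) Lc).card : ℝ)))⁻¹)) * (compRows Lc M' lev rs (n + 1) *ᵥ (hv x)) b')) •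
          (perF M' (dper M' (fun x z a e => ∑' m : Site (d + 1), (1 / 2 : ℝ) *
            (vh₂SAt (toSite (rs 0)) Lc b.2 (b.1 : Site (d + 1)) b'.2 (translate M' (b'.1 : Site (d + 1)) m) x z a e
              + vh₂SAt (toSite (rs 0)) Lc b'.2 (translate M' (b'.1 : Site (d + 1)) m) b.2 (b.1 : Site (d + 1)) x z a e)))).submatrix
            (fun k : κ => ((pμ' k, Sum.inr (mμ' k)) : Idx M' (Fib d))) (fun e : ↥(pbox M') × Fin (d + 1) => ((e.1, Sum.inl e.2) : Idx M' (Fib d))))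
          + (((Lc : ℝ) ^ (d + 1) * stepScale d Lc (lev 0))⁻¹ •
        ∑ b : ↥(pbox M') × Fin (d + 1), ∑ b' : ↥(pbox M') × Fin (d + 1), (((c * (((Lc : ℝ) ^ (d + 1) * stepScale d Lc (lev 0)) * (∏ i ∈ range (n + 1), (stepScale d Lc (lev (i + 1)) * ((box (d + 1) Lc).card : ℝ)))⁻¹)) * (compRows Lc M' lev rs (n + 1) *ᵥ (hv z)) b) * ((c * (((Lc : ℝ) ^ (d + 1) * stepScale d Lc (lev 0)) * (∏ i ∈ range (n + 1), (stepScale d Lc (lev (i + 1)) * ((box (d + 1) Lc).card : ℝ)))⁻¹)) * (compRows Lc M' lev rs (n + 1) *ᵥ (hv y)) b')) •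
          (perF M' (dper M' (fun x z a e => ∑' m : Site (d + 1), (1 / 2 : ℝ) *
            (vh₂SAt (toSite (rs 0)) Lc b.2 (b.1 : Site (d + 1)) b'.2 (translate M' (b'.1 : Site (d + 1)) m) x z a e
              + vh₂SAt (toSite (rs 0)) Lc b'.2 (translate M' (b'.1 : Site (d + 1)) m) b.2 (b.1 : Site (d + 1)) x z a e)))).submatrix
            (fun k : κ => ((pμ' k, Sum.inr (mμ' k)) : Idx M' (Fib d))) (fun e : ↥(pbox M') × Fin (d + 1) => ((e.1, Sum.inl e.2) : Idx M' (Fib d)))) := by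
  intro r x y z
  rw [hhv, Matrix.mulVec_add, Matrix.mulVec_smul, smul_comm r, ← smul_add]
  congr 1
  rw [Finset.smul_sum, ← Finset.sum_add_distrib]
  refine Finset.sum_congr rfl fun b _ => ?_
  rw [Finset.smul_sum, ← Finset.sum_add_distrib]
  refine Finset.sum_congr rfl fun b' _ => ?_
  rw [Pi.add_apply, Pi.smul_apply, smul_eq_mul, smul_smul, ← add_smul]
  congr 1
  ring

/-! ## §2 #21's `c2` row with the fine second jet on the diagonal of the bilinear companion -/

/-- [folklore] **`torus_c2_tower_polar` — #21's ∕ #41c's `c2` AT `Q₁₂f v v := c² • compIns₂₂ … h h`** (`h := hv v`): I-5 `torus_c2_tower` after ONE `compIns₂₂_self`;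
#21's `hW₁ hW₂` VERBATIM, `D̄₂` = the PURE SQUARE. -/
theorem torus_c2_tower_polar (hrs : ∀ k, rs k ∈ box (d + 1) Lc) (h : ↥(pbox (towerTorus Lc M' (n + 1))) × Fin (d + 1) → ℝ)
    {W₁ W₂ : Matrix (↥(pbox (towerTorus Lc M' (n + 1))) × Fin (d + 1)) (NParam Lc M' rs (n + 1)) ℝ}
    (hW₁ : W₁ = Matrix.of fun (b : (↥(pbox (towerTorus Lc M' (n + 1))) × Fin (d + 1))) (e : NParam Lc M' rs (n + 1)) =>
      -(c * h b * evalN Lc M' rs (n + 1) (fun b' : (↥(pbox (towerTorus Lc M' (n + 1))) × Fin (d + 1)) => (b'.1 : Site (d + 1)) + unitVec b'.2) b e))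
    (hW₂ : W₂ = Matrix.of fun (b : (↥(pbox (towerTorus Lc M' (n + 1))) × Fin (d + 1))) (e : NParam Lc M' rs (n + 1)) =>
      (c * h b) ^ 2 * evalN Lc M' rs (n + 1) (fun b' : (↥(pbox (towerTorus Lc M' (n + 1))) × Fin (d + 1)) => (b'.1 : Site (d + 1)) + unitVec b'.2) b e) :
    c ^ 2 • compIns₂₂ Lc M' lev rs (n + 1) h h * towerGen Lc M' rs (n + 1) + (2 : ℝ) • (c • compIns₁ Lc M' lev rs (n + 1) h * W₁) + compRows Lc M' lev rs (n + 1) * W₂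
      = Matrix.fromCols
          (Matrix.of fun (a : ↥(pbox M') × Fin (d + 1)) (t : Res (toSite (rs 0)) Lc M') =>
            (c ^ 2 * (∏ i ∈ range (n + 1), (stepScale d Lc (lev (i + 1)) * ((box (d + 1) Lc).card : ℝ)))⁻¹)
              * ((compRows Lc M' lev rs (n + 1) *ᵥ h) a) ^ 2 * tdelta M' ((a.1 : Site (d + 1)) + unitVec a.2) t.1)
          (0 : Matrix (↥(pbox M') × Fin (d + 1)) (NParam Lc (fine Lc M') (fun k => rs (k + 1)) n) ℝ) := by
  rw [compIns₂₂_self]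
  exact torus_c2_tower Lc M' lev rs hrs n c h hW₁ hW₂

end Directional

end Summit.QuantumFields.BalabanUV.Beta.FP.TorusCompositeRowsDirectional

end
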